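import Literature.AlgebraicGeometry.Resolution.NormalizationInExtension
import Literature.AlgebraicGeometry.Resolution.BirationalLocalIso
import Literature.AlgebraicGeometry.Resolution.RegularLocalRingsNormal
import Literature.AlgebraicGeometry.Resolution.ResolutionGlue
import Literature.AlgebraicGeometry.Motives.FunctionFieldOver

/-!
# Crux `Picover` (stmt-ResolutionOfSingularities-0554), line `degree-p-tower`: the base case

The degree-`p ^ 0` layer of the tower induction of the line `degree-p-tower` for the crux
`Summit.ResolutionOfSingularities.ResolutionOfSingularities.Theses.PAlteration.Picover`.

**Statement** (`stub_baseCase`). Let `W` be a regular integral scheme and `L ⊇ K(W)` a finite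
extension of its function field of degree `[L : K(W)] = 1`. Assume the function-field
identification `e : K(W^L) ≃ L` of the normalization `W^L = normalizationIn W L` of `W` in `L`,
compatible with `ι^♯ : K(W) → K(W^L)` (`ι = normalizationInι W L : W^L → W`). Then `W^L` has a
resolution of singularities.

**Proof.** `[L : K(W)] = 1` makes `K(W) → L` bijective, so `ι^♯ = e⁻¹ ∘ (K(W) → L)` is bijective,
i.e. the stalk map of `ι` at the generic point of `W^L` is an isomorphism. The local rings of the
regular scheme `W` are integrally closed (Matsumura, Thm. 19.4), and `ι` is integral and dominant
between integral schemes, so `ι` is an isomorphism over `V = ⊤`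
(`isIso_morphismRestrict_of_isIntegralHom_of_normal`), hence an isomorphism (isomorphisms are
Zariski-local at the target). Thus `W^L ≅ W` is regular and is its own resolution.

Sources: Q. Liu, *Algebraic Geometry and Arithmetic Curves* (2002), 4.1.24–4.1.27;
H. Matsumura, *Commutative Ring Theory* (1987), Thm. 19.4.
-/

noncomputable section

set_option linter.dupNamespace false -- mandated namespace of this single-conjunct summit

open CategoryTheory AlgebraicGeometry TopologicalSpace
open Literature.AlgebraicGeometry.Resolution Literature.AlgebraicGeometry.Motives

namespace Summit.ResolutionOfSingularities.ResolutionOfSingularities.Theorems.Picover.BaseCase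

universe u

/-- For a dominant morphism `f : X' → X` of integral schemes whose function-field map
`f^♯ : K(X) → K(X')` is bijective, the stalk map of `f` at the generic point of `X'` is an
isomorphism (`f^♯` is that stalk map composed with the identity specialisation
`𝒪_{X, η_X} ⟶ 𝒪_{X, f η_{X'}}`, as `f η_{X'} = η_X`). [folklore] -/
theorem isIso_stalkMap_genericPoint_of_bijective {X X' : Scheme.{u}} [IsIntegral X]
    [IsIntegral X'] (f : X' ⟶ X) [IsDominant f]
    (h : Function.Bijective (RatFn.functionFieldMap f)) :
    IsIso (f.stalkMap (genericPoint X')) := by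
  have hη : f.base (genericPoint X') = genericPoint X := RatFn.genericPoint_eq_of_isDominant f
  haveI : IsIso (X.presheaf.stalkSpecializes (RatFn.specializes_genericPoint f)) := by
    have key : ∀ (y : X) (h : y ⤳ genericPoint X), y = genericPoint X →
        IsIso (X.presheaf.stalkSpecializes h) := by
      rintro y h rfl
      rw [show X.presheaf.stalkSpecializes h = 𝟙 _ from
        TopCat.Presheaf.stalkSpecializes_refl _ _]
      infer_instance
    exact key _ _ hη
  have h2 : IsIso (X.presheaf.stalkSpecializes (RatFn.specializes_genericPoint f) ≫
      f.stalkMap (genericPoint X')) :=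
    (ConcreteCategory.isIso_iff_bijective _).mpr h
  exact IsIso.of_isIso_comp_left (X.presheaf.stalkSpecializes (RatFn.specializes_genericPoint f))
    (f.stalkMap (genericPoint X'))

/-- An integral dominant morphism `f : X → Y` of integral schemes which is an isomorphism on
function fields, onto a scheme `Y` all of whose local rings are integrally closed, is an
isomorphism ("finite birational onto normal is an isomorphism", globally: over `V = ⊤` by
`isIso_morphismRestrict_of_isIntegralHom_of_normal`, and isomorphisms are local at the target).
[folklore] -/
theorem isIso_of_isIntegralHom_of_normal {X Y : Scheme.{u}} [IsIntegral X] [IsIntegral Y]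
    (f : X ⟶ Y) [IsIntegralHom f] [IsDominant f] (hstalk : IsIso (f.stalkMap (genericPoint X)))
    (hY : ∀ y : Y, IsIntegrallyClosed (Y.presheaf.stalk y)) : IsIso f := by
  have htop : IsIso (f ∣_ (⊤ : Y.Opens)) :=
    isIso_morphismRestrict_of_isIntegralHom_of_normal f hstalk ⊤ fun y _ => hY y
  have key : MorphismProperty.isomorphisms Scheme f :=
    (IsZariskiLocalAtTarget.iff_of_iSup_eq_top (P := MorphismProperty.isomorphisms Scheme)
      (f := f) (fun _ : Unit => (⊤ : Y.Opens)) iSup_const).mpr fun _ => htop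
  exact key

/-- **Degree one** (base case of the `p`-tower). If `W` is regular (hence normal) and
`[L : K(W)] = 1` then the normalization `W^L → W` is an integral dominant morphism of integral
schemes which is an isomorphism on function fields, hence an isomorphism, so `W^L` is regular and
is its own resolution. Takes the function-field identification `K(W^L) ≃ L` for `(W, L)` as a
hypothesis. [folklore] -/
theorem stub_baseCase : ∀ (W : Scheme.{0}) [IsIntegral W] (L : Type) [Field L] [Algebra W.functionField L] [FiniteDimensional W.functionField L], (∃ e : (normalizationIn W L).functionField ≃+* L, e.toRingHom.comp (RatFn.functionFieldMap (normalizationInι W L)) = algebraMap W.functionField L) → Scheme.IsRegular W → Module.finrank W.functionField L = 1 → Scheme.HasResolution (normalizationIn W L) := by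
  intro W _ L _ _ _ hK hreg hdeg
  obtain ⟨e, he⟩ := hK
  -- `K(W) → L` is bijective, `[L : K(W)]` being `1`
  have halg : Function.Bijective (algebraMap W.functionField L) :=
    Algebra.finrank_eq_one_iff_bijective_algebraMap.mp hdeg
  -- hence so is `ι^♯ : K(W) → K(W^L)`, as `e ∘ ι^♯ = (K(W) → L)`
  have hφ : Function.Bijective (RatFn.functionFieldMap (normalizationInι W L)) := by
    have h1 : Function.Bijective (e ∘ RatFn.functionFieldMap (normalizationInι W L)) := by
      have h2 := halg
      rw [← he] at h2
      exact h2
    exact (Function.Bijective.of_comp_iff' e.bijective _).mp h1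
  have hstalk : IsIso ((normalizationInι W L).stalkMap (genericPoint (normalizationIn W L))) :=
    isIso_stalkMap_genericPoint_of_bijective _ hφ
  -- the local rings of the regular scheme `W` are integrally closed, so `ι` is an isomorphism
  haveI : IsIso (normalizationInι W L) :=
    isIso_of_isIntegralHom_of_normal (normalizationInι W L) hstalk
      fun y => haveI := hreg y; isIntegrallyClosed_of_isRegularLocalRing _
  -- `W^L ≅ W` is regular, hence its own resolution
  exact (Scheme.IsRegular.of_iso (inv (normalizationInι W L)) hreg).hasResolution

end Summit.ResolutionOfSingularities.ResolutionOfSingularities.Theorems.Picover.BaseCase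

end
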